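import Summits.CriticalPhenomena.SAWScalingLimit.Theorems.SAWTotalPositivityBoundaryTP2Defs
import Summits.CriticalPhenomena.SAWScalingLimit.Theorems.SAWTotalPositivityBoundaryTP2Kernel
import Summits.CriticalPhenomena.SAWScalingLimit.Theorems.SAWTotalPositivityBoundaryTP2Symmetry
import Summits.CriticalPhenomena.SAWScalingLimit.Theorems.SAWTotalPositivityBoundaryTP2RectFacingPairs
import Summits.CriticalPhenomena.SAWScalingLimit.Theorems.EdgeOfPositivity.Negative.EdgeOfPositivityRectDomain
import Literature.Probability.Percolation.PlanarDuality
import HarnessLib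

/-!
# Crux `BoundaryTP2` (stmt-CriticalPhenomena-7115), line `Sketch`: stub `stub_rect_bottomRow`

Tool stub of the line's skeleton: on the box `R = discreteDomainGraph (rectDomain a b) 1`
(sites `{0..a} × {0..b}`, `b ≥ 1`) four sites `p₁ = (c₁,0)`, `p₂ = (c₂,0)`, `p₃ = (c₃,0)`,
`p₄ = (c₄,0)` of the bottom side with `c₁ < c₂ < c₃ < c₄ ≤ a` satisfy the three hypotheses of the
crux:

* (i) interlacing — every self-avoiding path `P : p₁ → p₃` meets every self-avoiding path
  `Q : p₂ → p₄`. EXTENSION TRICK with a 2-deep frame: in `ℤ²`, prolong `P` into the left-right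
  crossing `(-1,-1) → ⋯ → (c₁,-1) → (c₁,0) ⋯P⋯ (c₃,0) → (c₃,-1) → (c₃,-2) → ⋯ → (a+1,-2)` of the big
  box `[-1, a+1] × [-2, b+1]`, and `Q` into the bottom-top crossing
  `(c₂,-2) → (c₂,-1) → (c₂,0) ⋯Q⋯ (c₄,0) → (c₄,-1) → ⋯ → (a+1,-1) → (a+1,0) ↑ (a+1,b+1)` of the same
  box; the discrete Jordan lemma `Literature.Probability.Percolation.exists_mem_support_of_crossing`
  gives a common vertex, and the added vertices of either walk avoid the other walk (they have a
  negative ordinate or abscissa `a+1`, off the box, and the two antenna systems are disjoint because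
  `c₁ < c₂ < c₃ < c₄`), so the common vertex is common to `P` and `Q`;
* (ii) `(p₁p₂ | p₃p₄)` is realised by the two bottom segments `[c₁,c₂] × {0}` and `[c₃,c₄] × {0}`
  (disjoint as `c₂ < c₃`);
* (iii) `(p₁p₄ | p₂p₃)` is realised by the middle bottom segment `[c₂,c₃] × {0}` and the detour
  `p₁ → (0,0) ↑ (0,b) → (a,b) ↓ (a,0) → p₄` around the three other sides (disjoint by coordinates:
  `0 ≤ c₁ < c₂`, `c₃ < c₄ ≤ a`, `b ≥ 1`).
-/

noncomputable section

namespace Summit.CriticalPhenomena.SAWScalingLimit.Theorems.BoundaryTP2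

open Literature.Probability.LatticeModels Literature.Probability.RandomPlanarGeometry
open Summit.CriticalPhenomena.SAWScalingLimit.Theorems.EdgeOfPositivity.Negative

/-! ### Straight runs with coordinate-controlled supports -/

/-- A vertical lattice segment `{i} × {m..n}` of `ℤ²` (`m ≤ n`) carries a lattice walk from `(i,m)` up
to `(i,n)` all of whose vertices lie on that segment. [folklore] -/
private theorem exists_zdColWalk (i m n : ℤ) (hmn : m ≤ n) :
    ∃ W : (zdGraph 2).Walk (st i m) (st i n), ∀ z ∈ W.support, z 0 = i ∧ m ≤ z 1 ∧ z 1 ≤ n := by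
  -- adapted from `exists_zdColWalk` in `…BoundaryTP2RectFacingPairs`
  induction n, hmn using Int.leInduction with
  | base =>
    refine ⟨SimpleGraph.Walk.nil, fun z hz => ?_⟩
    rw [SimpleGraph.Walk.support_nil, List.mem_singleton] at hz
    subst hz
    rw [st_zero, st_one]
    exact ⟨rfl, le_rfl, le_rfl⟩
  | succ n hmn ih =>
    obtain ⟨W, hW⟩ := ih
    refine ⟨W.concat (zdGraph_adj_st_succ_right i n), fun z hz => ?_⟩
    rw [SimpleGraph.Walk.support_concat, List.mem_append, List.mem_singleton] at hz
    rcases hz with hz | rfl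
    · have := hW z hz
      omega
    · rw [st_zero, st_one]
      omega

/-- A horizontal lattice segment `{m..n} × {j}` of `ℤ²` (`m ≤ n`) carries a lattice walk from `(m,j)`
rightwards to `(n,j)` all of whose vertices lie on that segment. [folklore] -/
private theorem exists_zdRowWalk (j m n : ℤ) (hmn : m ≤ n) :
    ∃ W : (zdGraph 2).Walk (st m j) (st n j), ∀ z ∈ W.support, z 1 = j ∧ m ≤ z 0 ∧ z 0 ≤ n := by
  induction n, hmn using Int.leInduction with
  | base =>
    refine ⟨SimpleGraph.Walk.nil, fun z hz => ?_⟩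
    rw [SimpleGraph.Walk.support_nil, List.mem_singleton] at hz
    subst hz
    rw [st_zero, st_one]
    exact ⟨rfl, le_rfl, le_rfl⟩
  | succ n hmn ih =>
    obtain ⟨W, hW⟩ := ih
    refine ⟨W.concat (zdGraph_adj_st_succ_left n j), fun z hz => ?_⟩
    rw [SimpleGraph.Walk.support_concat, List.mem_append, List.mem_singleton] at hz
    rcases hz with hz | rfl
    · have := hW z hz
      omega
    · rw [st_zero, st_one]
      omega

/-- The vertical segment `{i} × {m..n}` of the box (`0 ≤ i ≤ a`, `0 ≤ m ≤ n ≤ b`) carries a walk of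
the box graph from `(i,m)` up to `(i,n)` all of whose vertices lie on that segment. [folklore] -/
private theorem exists_boxColWalk (a b : ℕ) {i m n : ℤ} (hi0 : 0 ≤ i) (hia : i ≤ a) (hm : 0 ≤ m)
    (hmn : m ≤ n) (hn : n ≤ b) :
    ∃ W : (discreteDomainGraph (rectDomain a b) 1).Walk (st i m) (st i n),
      ∀ z ∈ W.support, z 0 = i ∧ m ≤ z 1 ∧ z 1 ≤ n := by
  -- adapted from `exists_boxColWalk` in `…BoundaryTP2RectFacingPairs`
  induction n, hmn using Int.leInduction with
  | base =>
    refine ⟨SimpleGraph.Walk.nil, fun z hz => ?_⟩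
    rw [SimpleGraph.Walk.support_nil, List.mem_singleton] at hz
    subst hz
    rw [st_zero, st_one]
    exact ⟨rfl, le_rfl, le_rfl⟩
  | succ n hmn ih =>
    obtain ⟨W, hW⟩ := ih (by omega)
    have hadj : (discreteDomainGraph (rectDomain a b) 1).Adj (st i n) (st i (n + 1)) := by
      refine adj_rect_iff.2 ⟨zdGraph_adj_st_succ_right i n, ?_, ?_⟩
      · rw [mem_rectSites_iff, st_zero, st_one]; omega
      · rw [mem_rectSites_iff, st_zero, st_one]; omega
    refine ⟨W.concat hadj, fun z hz => ?_⟩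
    rw [SimpleGraph.Walk.support_concat, List.mem_append, List.mem_singleton] at hz
    rcases hz with hz | rfl
    · have := hW z hz
      omega
    · rw [st_zero, st_one]
      omega

/-- The horizontal segment `{m..n} × {j}` of the box (`0 ≤ j ≤ b`, `0 ≤ m ≤ n ≤ a`) carries a walk
of the box graph from `(m,j)` rightwards to `(n,j)` all of whose vertices lie on that segment.
[folklore] -/
private theorem exists_boxRowWalk (a b : ℕ) {j m n : ℤ} (hj0 : 0 ≤ j) (hjb : j ≤ b) (hm : 0 ≤ m)
    (hmn : m ≤ n) (hn : n ≤ a) :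
    ∃ W : (discreteDomainGraph (rectDomain a b) 1).Walk (st m j) (st n j),
      ∀ z ∈ W.support, z 1 = j ∧ m ≤ z 0 ∧ z 0 ≤ n := by
  induction n, hmn using Int.leInduction with
  | base =>
    refine ⟨SimpleGraph.Walk.nil, fun z hz => ?_⟩
    rw [SimpleGraph.Walk.support_nil, List.mem_singleton] at hz
    subst hz
    rw [st_zero, st_one]
    exact ⟨rfl, le_rfl, le_rfl⟩
  | succ n hmn ih =>
    obtain ⟨W, hW⟩ := ih (by omega)
    have hadj : (discreteDomainGraph (rectDomain a b) 1).Adj (st n j) (st (n + 1) j) := by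
      refine adj_rect_iff.2 ⟨zdGraph_adj_st_succ_left n j, ?_, ?_⟩
      · rw [mem_rectSites_iff, st_zero, st_one]; omega
      · rw [mem_rectSites_iff, st_zero, st_one]; omega
    refine ⟨W.concat hadj, fun z hz => ?_⟩
    rw [SimpleGraph.Walk.support_concat, List.mem_append, List.mem_singleton] at hz
    rcases hz with hz | rfl
    · have := hW z hz
      omega
    · rw [st_zero, st_one]
      omega

/-! ### (i) Interlacing by the extension trick (2-deep frame) -/

/-- On the box `{0..a} × {0..b}`, four bottom sites `(c₁,0), (c₂,0), (c₃,0), (c₄,0)` with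
`0 ≤ c₁ < c₂ < c₃ < c₄ ≤ a` are interlaced: every self-avoiding path `(c₁,0) → (c₃,0)` of the box
graph meets every self-avoiding path `(c₂,0) → (c₄,0)`. Proof: prolong the first (in `ℤ²`) into
the left-right crossing `(-1,-1) → ⋯ → (c₁,-1) → (c₁,0) ⋯ (c₃,0) → (c₃,-1) → (c₃,-2) → ⋯ → (a+1,-2)`
of `[-1,a+1] × [-2,b+1]` and the second into the bottom-top crossing
`(c₂,-2) → (c₂,-1) → (c₂,0) ⋯ (c₄,0) → (c₄,-1) → ⋯ → (a+1,-1) ↑ (a+1,b+1)`; the two crossings meet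
(`exists_mem_support_of_crossing`), and the added vertices of each avoid the other. [folklore] -/
private theorem interlaced_bottomRow (a b : ℕ) {c₁ c₂ c₃ c₄ : ℤ} (h₁ : 0 ≤ c₁) (h₁₂ : c₁ < c₂)
    (h₂₃ : c₂ < c₃) (h₃₄ : c₃ < c₄) (h₄ : c₄ ≤ a) :
    Interlaced (discreteDomainGraph (rectDomain a b) 1) (st c₁ 0) (st c₂ 0) (st c₃ 0) (st c₄ 0) := by
  intro P Q
  have hle : discreteDomainGraph (rectDomain a b) 1 ≤ zdGraph 2 :=
    discreteDomainGraph_le_zdGraph (rectDomain a b) 1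
  have hp₁ : st c₁ 0 ∈ rectSites a b := by rw [mem_rectSites_iff, st_zero, st_one]; omega
  have hp₂ : st c₂ 0 ∈ rectSites a b := by rw [mem_rectSites_iff, st_zero, st_one]; omega
  -- the original supports lie in the box `[0, a] × [0, b]`
  have hP₀ : ∀ z ∈ P.1.support, (0 : ℤ) ≤ z 0 ∧ z 0 ≤ (a : ℤ) ∧ (0 : ℤ) ≤ z 1 ∧ z 1 ≤ (b : ℤ) :=
    fun z hz => and_assoc.1 (mem_rectSites_iff.1 (support_subset_rectSites hp₁ P.1 z hz))
  have hQ₀ : ∀ z ∈ Q.1.support, (0 : ℤ) ≤ z 0 ∧ z 0 ≤ (a : ℤ) ∧ (0 : ℤ) ≤ z 1 ∧ z 1 ≤ (b : ℤ) :=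
    fun z hz => and_assoc.1 (mem_rectSites_iff.1 (support_subset_rectSites hp₂ Q.1 z hz))
  -- the four vertical unit steps between row `-1` and row `0`
  have e₁ : (zdGraph 2).Adj (st c₁ (-1)) (st c₁ 0) := by
    have := zdGraph_adj_st_succ_right c₁ (-1)
    rwa [neg_add_cancel] at this
  have e₂ : (zdGraph 2).Adj (st c₃ 0) (st c₃ (-1)) := by
    have := zdGraph_adj_st_succ_right c₃ (-1)
    rw [neg_add_cancel] at this
    exact this.symm
  have f₁ : (zdGraph 2).Adj (st c₂ (-1)) (st c₂ 0) := by
    have := zdGraph_adj_st_succ_right c₂ (-1)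
    rwa [neg_add_cancel] at this
  have f₂ : (zdGraph 2).Adj (st c₄ 0) (st c₄ (-1)) := by
    have := zdGraph_adj_st_succ_right c₄ (-1)
    rw [neg_add_cancel] at this
    exact this.symm
  -- the straight runs of the two antenna systems
  obtain ⟨R₁, hR₁⟩ := exists_zdRowWalk (-1) (-1) c₁ (by omega)
  obtain ⟨D₃, hD₃⟩ := exists_zdColWalk c₃ (-2) (-1) (by omega)
  obtain ⟨R₂, hR₂⟩ := exists_zdRowWalk (-2) c₃ (a + 1) (by omega)
  obtain ⟨U₂, hU₂⟩ := exists_zdColWalk c₂ (-2) (-1) (by omega)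
  obtain ⟨R₃, hR₃⟩ := exists_zdRowWalk (-1) c₄ (a + 1) (by omega)
  obtain ⟨U₃, hU₃⟩ := exists_zdColWalk (a + 1) (-1) (b + 1) (by omega)
  -- the prolonged `P`: a left-right crossing of the big box
  obtain ⟨P', hP'⟩ : ∃ P' : (zdGraph 2).Walk (st (-1) (-1)) (st (a + 1) (-2)), ∀ z ∈ P'.support,
      z ∈ P.1.support ∨ (z 1 = -1 ∧ -1 ≤ z 0 ∧ z 0 ≤ c₁) ∨ (z 0 = c₃ ∧ -2 ≤ z 1 ∧ z 1 ≤ -1) ∨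
        (z 1 = -2 ∧ c₃ ≤ z 0 ∧ z 0 ≤ a + 1) := by
    refine ⟨R₁.append (SimpleGraph.Walk.cons e₁ ((P.1.mapLe hle).append
      (SimpleGraph.Walk.cons e₂ (D₃.reverse.append R₂)))), fun z hz => ?_⟩
    simp only [SimpleGraph.Walk.mem_support_append_iff, SimpleGraph.Walk.support_cons,
      List.mem_cons, SimpleGraph.Walk.support_mapLe_eq_support, SimpleGraph.Walk.support_reverse,
      List.mem_reverse] at hz
    rcases hz with hz | rfl | hz | rfl | hz | hz
    · exact Or.inr (Or.inl (hR₁ z hz))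
    · refine Or.inr (Or.inl ?_)
      rw [st_zero, st_one]
      omega
    · exact Or.inl hz
    · exact Or.inl P.1.end_mem_support
    · exact Or.inr (Or.inr (Or.inl (hD₃ z hz)))
    · exact Or.inr (Or.inr (Or.inr (hR₂ z hz)))
  -- the prolonged `Q`: a bottom-top crossing of the big box
  obtain ⟨Q', hQ'⟩ : ∃ Q' : (zdGraph 2).Walk (st c₂ (-2)) (st (a + 1) (b + 1)), ∀ z ∈ Q'.support,
      z ∈ Q.1.support ∨ (z 0 = c₂ ∧ -2 ≤ z 1 ∧ z 1 ≤ -1) ∨ (z 1 = -1 ∧ c₄ ≤ z 0 ∧ z 0 ≤ a + 1) ∨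
        (z 0 = a + 1 ∧ -1 ≤ z 1 ∧ z 1 ≤ b + 1) := by
    refine ⟨U₂.append (SimpleGraph.Walk.cons f₁ ((Q.1.mapLe hle).append
      (SimpleGraph.Walk.cons f₂ (R₃.append U₃)))), fun z hz => ?_⟩
    simp only [SimpleGraph.Walk.mem_support_append_iff, SimpleGraph.Walk.support_cons,
      List.mem_cons, SimpleGraph.Walk.support_mapLe_eq_support] at hz
    rcases hz with hz | rfl | hz | rfl | hz | hz
    · exact Or.inr (Or.inl (hU₂ z hz))
    · refine Or.inr (Or.inl ?_)
      rw [st_zero, st_one]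
      omega
    · exact Or.inl hz
    · exact Or.inl Q.1.end_mem_support
    · exact Or.inr (Or.inr (Or.inl (hR₃ z hz)))
    · exact Or.inr (Or.inr (Or.inr (hU₃ z hz)))
  -- both prolonged walks stay in the big box `[-1, a+1] × [-2, b+1]`
  have hP'box : ∀ z ∈ P'.support,
      (-1 : ℤ) ≤ z 0 ∧ z 0 ≤ (a : ℤ) + 1 ∧ (-2 : ℤ) ≤ z 1 ∧ z 1 ≤ (b : ℤ) + 1 := by
    intro z hz
    rcases hP' z hz with hz | hz | hz | hz
    · have := hP₀ z hz
      omega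
    · omega
    · omega
    · omega
  have hQ'box : ∀ z ∈ Q'.support,
      (-1 : ℤ) ≤ z 0 ∧ z 0 ≤ (a : ℤ) + 1 ∧ (-2 : ℤ) ≤ z 1 ∧ z 1 ≤ (b : ℤ) + 1 := by
    intro z hz
    rcases hQ' z hz with hz | hz | hz | hz
    · have := hQ₀ z hz
      omega
    · omega
    · omega
    · omega
  -- a left-right crossing meets a bottom-top crossing of the big box
  obtain ⟨z, hzP, hzQ⟩ := Literature.Probability.Percolation.exists_mem_support_of_crossing
    P' Q' hP'box hQ'box (st_zero _ _) (st_zero _ _) (st_one _ _) (st_one _ _)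
  -- the common vertex is a vertex of both original paths
  refine ⟨z, ?_⟩
  rcases hP' z hzP with hzP | hzP | hzP | hzP
  · rcases hQ' z hzQ with hzQ | hzQ | hzQ | hzQ
    · exact ⟨hzP, hzQ⟩
    all_goals
      exfalso
      have := hP₀ z hzP
      omega
  all_goals
    exfalso
    rcases hQ' z hzQ with hzQ | hzQ | hzQ | hzQ
    · have := hQ₀ z hzQ
      omega
    all_goals omega

/-! ### (ii), (iii) Disjoint realisations -/

/-- On the box `{0..a} × {0..b}`, the pairing `((c₁,0)(c₂,0) | (c₃,0)(c₄,0))` of bottom sites with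
`0 ≤ c₁ ≤ c₂ < c₃ ≤ c₄ ≤ a` is realised by vertex-disjoint self-avoiding paths of the box graph: the
two bottom segments `[c₁,c₂] × {0}` and `[c₃,c₄] × {0}` (disjoint as `c₂ < c₃`). [folklore] -/
private theorem disjointPaths_bottomRow_adjacent (a b : ℕ) {c₁ c₂ c₃ c₄ : ℤ} (h₁ : 0 ≤ c₁)
    (h₁₂ : c₁ ≤ c₂) (h₂₃ : c₂ < c₃) (h₃₄ : c₃ ≤ c₄) (h₄ : c₄ ≤ a) :
    DisjointPaths (discreteDomainGraph (rectDomain a b) 1) (st c₁ 0) (st c₂ 0) (st c₃ 0) (st c₄ 0) := by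
  have hb0 : (0 : ℤ) ≤ b := Nat.cast_nonneg b
  obtain ⟨W₁, hW₁⟩ := exists_boxRowWalk a b (j := 0) le_rfl hb0 h₁ h₁₂ (by omega)
  obtain ⟨W₂, hW₂⟩ := exists_boxRowWalk a b (j := 0) le_rfl hb0 (by omega) h₃₄ h₄
  refine ⟨W₁.toPath, W₂.toPath, ?_⟩
  -- abscissae `≤ c₂` against abscissae `≥ c₃ > c₂`
  intro z hz₁ hz₂
  have hz₁' := hW₁ z (W₁.support_toPath_subset_support hz₁)
  have hz₂' := hW₂ z (W₂.support_toPath_subset_support hz₂)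
  omega

/-- On the box `{0..a} × {0..b}` with `b ≥ 1`, the pairing `((c₁,0)(c₄,0) | (c₂,0)(c₃,0))` of bottom
sites with `0 ≤ c₁ < c₂ ≤ c₃ < c₄ ≤ a` is realised by vertex-disjoint self-avoiding paths of the box
graph: the detour `(c₁,0) → (0,0) ↑ (0,b) → (a,b) ↓ (a,0) → (c₄,0)` around the three other sides
(row `0` at abscissae `≤ c₁` or `≥ c₄`, column `0`, row `b`, column `a`) and the middle bottom
segment `[c₂,c₃] × {0}` (row `0`, abscissae in `[c₂,c₃]`, so `> 0` and `< a`). [folklore] -/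
private theorem disjointPaths_bottomRow_nested (a b : ℕ) (hb : 1 ≤ b) {c₁ c₂ c₃ c₄ : ℤ}
    (h₁ : 0 ≤ c₁) (h₁₂ : c₁ < c₂) (h₂₃ : c₂ ≤ c₃) (h₃₄ : c₃ < c₄) (h₄ : c₄ ≤ a) :
    DisjointPaths (discreteDomainGraph (rectDomain a b) 1) (st c₁ 0) (st c₄ 0) (st c₂ 0) (st c₃ 0) := by
  have ha0 : (0 : ℤ) ≤ a := Nat.cast_nonneg a
  have hb0 : (0 : ℤ) ≤ b := Nat.cast_nonneg b
  -- the detour: left along row `0`, up column `0`, along row `b`, down column `a`, left along row `0`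
  obtain ⟨A₁, hA₁⟩ := exists_boxRowWalk a b (j := 0) le_rfl hb0 le_rfl h₁ (by omega : c₁ ≤ (a : ℤ))
  obtain ⟨A₂, hA₂⟩ := exists_boxColWalk a b (i := 0) le_rfl ha0 le_rfl hb0 le_rfl
  obtain ⟨A₃, hA₃⟩ := exists_boxRowWalk a b (j := b) hb0 le_rfl le_rfl ha0 le_rfl
  obtain ⟨A₄, hA₄⟩ := exists_boxColWalk a b (i := a) ha0 le_rfl le_rfl hb0 le_rfl
  obtain ⟨A₅, hA₅⟩ := exists_boxRowWalk a b (j := 0) le_rfl hb0 (by omega : (0 : ℤ) ≤ c₄) h₄ le_rfl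
  -- the middle bottom segment
  obtain ⟨M, hM⟩ := exists_boxRowWalk a b (j := 0) le_rfl hb0 (by omega : (0 : ℤ) ≤ c₂) h₂₃
    (by omega : c₃ ≤ (a : ℤ))
  refine ⟨((((A₁.reverse.append A₂).append A₃).append A₄.reverse).append A₅.reverse).toPath,
    M.toPath, ?_⟩
  intro z hz₁ hz₂
  have hz₁' := SimpleGraph.Walk.support_toPath_subset_support _ hz₁
  have hz₂' := hM z (SimpleGraph.Walk.support_toPath_subset_support _ hz₂)
  simp only [SimpleGraph.Walk.mem_support_append_iff, SimpleGraph.Walk.support_reverse,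
    List.mem_reverse] at hz₁'
  rcases hz₁' with (((hz | hz) | hz) | hz) | hz
  · have := hA₁ z hz
    omega
  · have := hA₂ z hz
    omega
  · have := hA₃ z hz
    omega
  · have := hA₄ z hz
    omega
  · have := hA₅ z hz
    omega

/-! ### The registered stub -/

/-- **Tool stub `stub_rect_bottomRow`.** On the box `{0..a}×{0..b}` with `b ≥ 1`, four sites
`(c₁,0),(c₂,0),(c₃,0),(c₄,0)` of the bottom side with `c₁ < c₂ < c₃ < c₄ ≤ a` satisfy the three
hypotheses of the crux: interlacing (every path `(c₁,0) → (c₃,0)` meets every path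
`(c₂,0) → (c₄,0)`: extend both to crossings of the frame-enlarged box `[-1,a+1]×[-2,b+1]` and apply
the discrete Jordan lemma `Literature.Probability.Percolation.exists_mem_support_of_crossing`) and
disjoint realisability of `((c₁,0)(c₂,0) | (c₃,0)(c₄,0))` (two bottom segments) and of
`((c₁,0)(c₄,0) | (c₂,0)(c₃,0))` (around the other three sides / the middle bottom segment).
[folklore] -/
theorem stub_rect_bottomRow (a b : ℕ) (hb : 1 ≤ b) {c₁ c₂ c₃ c₄ : ℕ} (h₁₂ : c₁ < c₂) (h₂₃ : c₂ < c₃)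
    (h₃₄ : c₃ < c₄) (h₄ : c₄ ≤ a) :
    Interlaced (discreteDomainGraph (rectDomain a b) 1) (st c₁ 0) (st c₂ 0) (st c₃ 0) (st c₄ 0) ∧
    DisjointPaths (discreteDomainGraph (rectDomain a b) 1) (st c₁ 0) (st c₂ 0) (st c₃ 0) (st c₄ 0) ∧
    DisjointPaths (discreteDomainGraph (rectDomain a b) 1) (st c₁ 0) (st c₄ 0) (st c₂ 0) (st c₃ 0) :=
  ⟨interlaced_bottomRow a b (Nat.cast_nonneg c₁) (by exact_mod_cast h₁₂) (by exact_mod_cast h₂₃)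
      (by exact_mod_cast h₃₄) (by exact_mod_cast h₄),
    disjointPaths_bottomRow_adjacent a b (Nat.cast_nonneg c₁) (by exact_mod_cast h₁₂.le)
      (by exact_mod_cast h₂₃) (by exact_mod_cast h₃₄.le) (by exact_mod_cast h₄),
    disjointPaths_bottomRow_nested a b hb (Nat.cast_nonneg c₁) (by exact_mod_cast h₁₂)
      (by exact_mod_cast h₂₃.le) (by exact_mod_cast h₃₄) (by exact_mod_cast h₄)⟩

end Summit.CriticalPhenomena.SAWScalingLimit.Theorems.BoundaryTP2
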